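import Mathlib
import Literature.RingTheory.LocalCohomology.CechFiniteness
import Literature.RingTheory.LocalCohomology.CechH2Noetherian
import Literature.RingTheory.LocalCohomology.SyzygyModule

/-!
# Depth and `H²`-torsion of a second syzygy module — lemma (H1b) of the SGA 2 XIII 2.1 programme

Route `SkinnerWilesDefectOne`, crux `ReducibleOrdinaryProModular` (stmt-Langlands-12919), line
`fine-selmer-codimension-two`, registered sub-goal (H1b) `stub_raynaudConnectedness_auxDepthTorsion` of
stub (R) `stub_raynaudConnectedness` (Grothendieck's connectedness theorem [SGA 2 XIII 2.1], lead c3's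
HLVT-free programme: reflexive hull + algebraic local Lefschetz theorem
`…AlgebraicLefschetz.lean`, whose hypothesis "`(y)^N · H²(y; M) = 0`" is what this file supplies).

**Theorem** (`Theorems.isWeaklyRegular_and_smul_H2_eq_zero_of_secondSyzygy`, universe-polymorphic; the
registered signature `FineSelmerCodimensionTwo.stub_raynaudConnectedness_auxDepthTorsion` is its
universe-`0` instance, binders verbatim).  Let `R` be a Noetherian ring, `x₁, x₂, x₃` an `R`-regular
sequence with every `xᵢ ∈ √(y₁, …, y_s)`, and `M` a **second syzygy**: `0 → M →Φ R^a →Ψ R^b` exact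
(`Φ` injective, `im Φ = ker Ψ`).  Then

1. `x₁, x₂` is an `M`-regular sequence (tree `isWeaklyRegular_pair_of_exact`, `SyzygyModule.lean`:
   `x₁` is injective on `M ⊆ R^a`; if `x₂ m = x₁ m'` then `Φ m ∈ x₁ R^a` by regularity of `x₂` on
   `R^a/x₁R^a`, `Φ m = x₁ f`, `x₁ Ψ f = 0` forces `Ψ f = 0`, `f = Φ m₀`, `m = x₁ m₀`);
2. there is `N` with `r · c = 0` for every class `c ∈ H²(y; M) = Z¹/B¹` of the extended ordered Čech
   complex (tree `CechFiniteness.H2`) and every `r ∈ (y₁, …, y_s)^N`.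

Proof of 2 (Grothendieck, SGA 2 III 3.1–3.3 "`H^i_Y(F) = 0` for `i < prof_Y F`" and VIII 2.3, in the
tree's Čech language): with `C = im Ψ ⊆ R^b`, `0 → M → R^a → C → 0` is short exact; `H²(y; R^a) = 0`
as `R^a` has the regular sequence `x₁, x₂, x₃` in `√(y)` (tree `cech_exact_of_isRegular`, via
`Theorems.isRegular_pi_of_isRegular` / `Theorems.cech_exact_pi_of_isRegular`, the case `a = 0` being
trivial), so the connecting homomorphism maps `Z⁰(y; C)` ONTO `H²(y; M)` (tree
`isNoetherian_H2_of_exact`); and `Z⁰(y; C) ↪ Z⁰(y; R^b) = R^b` (depth `R^b ≥ 2`, tree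
`finite_ker_dC_zero_of_injective`) is a Noetherian module.  Hence `H²(y; M)` is finitely generated;
every class is killed by a power of each `y_j` (tree `exists_pow_smul_eq_dC`, Eisenbud A1.2), so a
single power of each `y_j` kills the finitely many generators, `(y) ≤ √(Ann H²)`, and
`(y)^N ≤ Ann H²` for some `N` (Mathlib `Ideal.exists_pow_le_of_le_radical_of_fg`) —
`Theorems.exists_pow_span_smul_H2_eq_zero`.

Sorry-free; no definitions; no named facts.  Mathlib searched (pin v4.32): `RingTheory.Sequence.IsRegular`,
`IsWeaklyRegular.isWeaklyRegular_rTensor` (used through the tree's `isWeaklyRegular_pi`),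
`Submodule.map_smul''`, `Module.annihilator`, `Ideal.exists_pow_le_of_le_radical_of_fg` (used); Mathlib's
`localCohomology` has no Čech comparison or depth vanishing, hence the tree's Čech library.

References: A. Grothendieck, SGA 2, Exp. III 3.1–3.3, Exp. VIII 2.3, Exp. XIII §2 (arXiv:math/0511279)
[Grothendieck1968SGA2]; D. Eisenbud, *The Geometry of Syzygies*, GTM 229, App. 1, Cor. A1.2, Thm. A1.3,
Prop. A1.16 [Eisenbud2005]; The Stacks Project, Tag 01FG, Tag 0A6R [StacksProject].
-/

set_option linter.dupNamespace false -- project-wide option (lakefile weak.linter.dupNamespace); `Summit.Langlands.Langlands` is the mandated namespace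
set_option autoImplicit false

namespace Summit.Langlands.Langlands.Theorems

open Literature.RingTheory.LocalCohomology RingTheory.Sequence

universe u

variable {R : Type u} [CommRing R] {s : ℕ} {y : Fin s → R}

/-! ## 1. Regular sequences on free modules of positive rank; `Č(y; R^n)` is exact in low degrees -/

/-- **An `R`-regular sequence is `R^n`-regular for `n ≥ 1`** (with the non-degeneracy clause
`R^n ≠ (rs) R^n`: project onto a coordinate).  The weak part is the tree's `isWeaklyRegular_pi` (flat
base change). [folklore] -/
theorem isRegular_pi_of_isRegular {rs : List R} (h : IsRegular R rs) {n : ℕ} (i : Fin n) :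
    IsRegular (Fin n → R) rs := by
  refine ⟨isWeaklyRegular_pi h.toIsWeaklyRegular n, fun htop => h.top_ne_smul ?_⟩
  have h' := congrArg (Submodule.map (LinearMap.proj (R := R) (φ := fun _ : Fin n => R) i)) htop
  rwa [Submodule.map_smul'', Submodule.map_top,
    LinearMap.range_eq_top.mpr (LinearMap.proj_surjective i)] at h'

/-- **The extended Čech complex of a free module `R^n` is exact in degrees `< 3`** when `R` has an
`R`-regular sequence `x₁, x₂, x₃` in `√(y)`: `R^n → Č⁰(R^n)` is injective, every `0`-cocycle comes from
`R^n`, every `1`-cocycle is a coboundary (`H⁰ = H¹ = H² = 0`).  For `n ≥ 1` this is the tree's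
`cech_exact_of_isRegular` (SGA 2 III 3.1–3.3) for the `R^n`-regular sequence `x₁, x₂, x₃`; for `n = 0`
all modules vanish. [cite: Grothendieck1968SGA2, Exp. III 3.1–3.3] -/
theorem cech_exact_pi_of_isRegular {x₁ x₂ x₃ : R} (hreg : IsRegular R [x₁, x₂, x₃])
    (hrad : ∀ r ∈ [x₁, x₂, x₃], r ∈ (Ideal.span (Set.range y)).radical) (n : ℕ) :
    (∀ p : Fin n → R, cechAug y (Fin n → R) p = 0 → p = 0) ∧
    (∀ c : CechObj y (Fin n → R) 0, dC 0 c = 0 → ∃ p : Fin n → R, cechAug y (Fin n → R) p = c) ∧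
    (∀ z : CechObj y (Fin n → R) 1, dC 1 z = 0 → ∃ c : CechObj y (Fin n → R) 0, dC 0 c = z) := by
  rcases Nat.eq_zero_or_pos n with rfl | hn
  · exact ⟨fun p _ => Subsingleton.elim _ _, fun c _ => ⟨0, Subsingleton.elim _ _⟩,
      fun z _ => ⟨0, Subsingleton.elim _ _⟩⟩
  · obtain ⟨h0, h1, h2⟩ := cech_exact_of_isRegular (y := y) [x₁, x₂, x₃] (Fin n → R)
      (isRegular_pi_of_isRegular hreg ⟨0, hn⟩) hrad
    exact ⟨h0 (by simp), h1 (by simp), h2 0 (by simp)⟩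

/-! ## 2. A uniform power of `(y)` kills a finitely generated `H²(y; M)` -/

/-- **If `H²(y; M)` is a Noetherian `R`-module then `(y₁, …, y_s)^N · H²(y; M) = 0` for some `N`.**
Every class is killed by a power of each `y_j` (tree `exists_pow_smul_eq_dC`: the Čech cohomology
classes are `y_j`-power torsion, Eisenbud Cor. A1.2); one power of `y_j` kills the finitely many
generators, so `(y) ≤ √(Ann H²)` and Mathlib's `Ideal.exists_pow_le_of_le_radical_of_fg` gives `N`.
[cite: Eisenbud2005, Cor. A1.2 with Thm. A1.3] -/
theorem exists_pow_span_smul_H2_eq_zero {M : Type u} [AddCommGroup M] [Module R M]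
    [IsNoetherian R (H2 (y := y) (M := M))] :
    ∃ N : ℕ, ∀ c : H2 (y := y) (M := M), ∀ r ∈ Ideal.span (Set.range y) ^ N, r • c = 0 := by
  classical
  -- every class is `y_j`-power torsion
  have htor : ∀ (c : H2 (y := y) (M := M)) (j : Fin s), ∃ n : ℕ, y j ^ n • c = 0 := by
    intro c j
    obtain ⟨⟨z, hz⟩, rfl⟩ := Submodule.Quotient.mk_surjective _ c
    obtain ⟨n, w, hw⟩ := exists_pow_smul_eq_dC 0 z (LinearMap.mem_ker.mp hz) j
    refine ⟨n, ?_⟩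
    show H2.mk (y j ^ n • z) (by rw [map_smul, LinearMap.mem_ker.mp hz, smul_zero]) = 0
    rw [H2.mk_eq_zero_iff]
    exact ⟨w, hw.symm⟩
  -- a single power of `y_j` kills the generators, hence everything
  obtain ⟨k, gen, hgen⟩ := Module.Finite.exists_fin (R := R) (M := H2 (y := y) (M := M))
  choose nf hnf using fun j l => htor (gen l) j
  have hann : ∀ j : Fin s,
      y j ^ (Finset.univ.sup (nf j)) ∈ Module.annihilator R (H2 (y := y) (M := M)) := by
    intro j
    rw [Module.mem_annihilator]
    intro c
    have hc : c ∈ Submodule.span R (Set.range gen) := by rw [hgen]; trivial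
    refine Submodule.span_induction ?_ ?_ ?_ ?_ hc
    · rintro _ ⟨l, rfl⟩
      have hle : nf j l ≤ Finset.univ.sup (nf j) := Finset.le_sup (Finset.mem_univ l)
      rw [← Nat.sub_add_cancel hle, pow_add, mul_smul, hnf, smul_zero]
    · exact smul_zero _
    · intro a b _ _ ha hb
      rw [smul_add, ha, hb, add_zero]
    · intro a b _ hb
      rw [smul_comm, hb, smul_zero]
  -- `(y) ≤ √(Ann H²)`, so `(y)^N ≤ Ann H²`
  have hle : Ideal.span (Set.range y) ≤ (Module.annihilator R (H2 (y := y) (M := M))).radical := by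
    rw [Ideal.span_le]
    rintro _ ⟨j, rfl⟩
    exact ⟨_, hann j⟩
  obtain ⟨N, hN⟩ := Ideal.exists_pow_le_of_le_radical_of_fg hle
    (Submodule.fg_span (Set.finite_range y))
  exact ⟨N, fun c r hr => Module.mem_annihilator.mp (hN hr) c⟩

/-! ## 3. The theorem: depth and `H²`-torsion of a second syzygy -/

/-- **Depth and `H²`-torsion of a second syzygy module** (lemma (H1b) of the lead's proof of SGA 2
XIII 2.1).  Let `R` be Noetherian with an `R`-regular sequence `x₁, x₂, x₃` in `√(y₁, …, y_s)`, and
`0 → M →Φ R^a →Ψ R^b` exact.  Then `x₁, x₂` is `M`-regular, and `(y)^N · H²(y; M) = 0` for some `N`: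
with `C = im Ψ`, the connecting homomorphism of `0 → M → R^a → C → 0` maps `Z⁰(y; C)` onto `H²(y; M)`
because `H²(y; R^a) = 0` (depth `3`), and `Z⁰(y; C) ⊆ Z⁰(y; R^b) = R^b` (depth `≥ 2`) is Noetherian; so
`H²(y; M)` is finitely generated and `y_j`-power torsion.
[cite: Grothendieck1968SGA2, Exp. III 3.1–3.3] -/
theorem isWeaklyRegular_and_smul_H2_eq_zero_of_secondSyzygy [IsNoetherianRing R] {x₁ x₂ x₃ : R}
    (hreg : IsRegular R [x₁, x₂, x₃]) (h₁ : x₁ ∈ (Ideal.span (Set.range y)).radical)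
    (h₂ : x₂ ∈ (Ideal.span (Set.range y)).radical) (h₃ : x₃ ∈ (Ideal.span (Set.range y)).radical)
    (M : Type u) [AddCommGroup M] [Module R M] {a b : ℕ} (Φ : M →ₗ[R] (Fin a → R))
    (Ψ : (Fin a → R) →ₗ[R] (Fin b → R)) (hΦ : Function.Injective Φ)
    (hrange : LinearMap.range Φ = LinearMap.ker Ψ) :
    IsWeaklyRegular M [x₁, x₂] ∧
      ∃ N : ℕ, ∀ c : H2 (y := y) (M := M), ∀ r ∈ Ideal.span (Set.range y) ^ N, r • c = 0 := by
  have hex : Function.Exact Φ Ψ := LinearMap.exact_iff.mpr hrange.symm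
  have hrad : ∀ r ∈ [x₁, x₂, x₃], r ∈ (Ideal.span (Set.range y)).radical := by
    intro r hr
    simp only [List.mem_cons, List.not_mem_nil, or_false] at hr
    rcases hr with rfl | rfl | rfl
    exacts [h₁, h₂, h₃]
  refine ⟨?_, ?_⟩
  · -- the regular pair (tree `isWeaklyRegular_pair_of_exact` with `D = R`)
    have h12 : IsWeaklyRegular R [x₁, x₂] := by
      have h := hreg.toIsWeaklyRegular
      rw [isWeaklyRegular_cons_iff, isWeaklyRegular_cons_iff] at h
      exact IsWeaklyRegular.cons h.1 (IsWeaklyRegular.cons h.2.1 (IsWeaklyRegular.nil _ _))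
    have h := isWeaklyRegular_pair_of_exact (D := R) Φ Ψ hΦ hex h12
    simpa using h
  · -- the torsion exponent: `H²(y; M)` is Noetherian
    obtain ⟨hG0, hG1, -⟩ := cech_exact_pi_of_isRegular (y := y) hreg hrad b
    obtain ⟨-, -, hF2⟩ := cech_exact_pi_of_isRegular (y := y) hreg hrad a
    have hfin : Module.Finite R (LinearMap.ker (dC (y := y) (M := LinearMap.range Ψ) 0)) :=
      finite_ker_dC_zero_of_injective (LinearMap.range Ψ).subtype
        (LinearMap.range Ψ).injective_subtype hG0 hG1
    haveI : IsNoetherian R (LinearMap.ker (dC (y := y) (M := LinearMap.range Ψ) 0)) :=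
      isNoetherian_of_isNoetherianRing_of_finite R _
    have hexr : Function.Exact Φ Ψ.rangeRestrict :=
      LinearMap.exact_iff.mpr (by rw [LinearMap.ker_rangeRestrict]; exact hrange.symm)
    haveI : IsNoetherian R (H2 (y := y) (M := M)) :=
      isNoetherian_H2_of_exact Φ Ψ.rangeRestrict hΦ (LinearMap.surjective_rangeRestrict Ψ) hexr hF2
    exact exists_pow_span_smul_H2_eq_zero

end Summit.Langlands.Langlands.Theorems

/-! ## 4. The registered sub-goal (verbatim signature) -/

namespace Summit.Langlands.Langlands.Cruxes.ReducibleOrdinaryProModular.FineSelmerCodimensionTwo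

/-- **Registered sub-goal (H1b) `stub_raynaudConnectedness_auxDepthTorsion` of stub (R)
`stub_raynaudConnectedness`**: for a Noetherian ring `R` with an `R`-regular sequence `x₁, x₂, x₃` in
`√(y)` and a second syzygy `0 → M → R^a → R^b`, the pair `x₁, x₂` is `M`-regular and a power of `(y)`
kills `H²(y; M)` — `Theorems.isWeaklyRegular_and_smul_H2_eq_zero_of_secondSyzygy` at universe `0`.
This is the depth / finiteness input ("dim `≥ 3`") of the algebraic local Lefschetz theorem
(`…AlgebraicLefschetz.lean`) in the lead's proof of Grothendieck's connectedness theorem.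
[cite: Grothendieck1968SGA2, Exp. III 3.1–3.3] -/
theorem stub_raynaudConnectedness_auxDepthTorsion : ∀ (R : Type) [CommRing R] [IsNoetherianRing R] (s : ℕ) (y : Fin s → R) (x₁ x₂ x₃ : R), RingTheory.Sequence.IsRegular R [x₁, x₂, x₃] → x₁ ∈ (Ideal.span (Set.range y)).radical → x₂ ∈ (Ideal.span (Set.range y)).radical → x₃ ∈ (Ideal.span (Set.range y)).radical → ∀ (M : Type) [AddCommGroup M] [Module R M] (a b : ℕ) (Φ : M →ₗ[R] (Fin a → R)) (Ψ : (Fin a → R) →ₗ[R] (Fin b → R)), Function.Injective Φ → LinearMap.range Φ = LinearMap.ker Ψ → RingTheory.Sequence.IsWeaklyRegular M [x₁, x₂] ∧ ∃ N : ℕ, ∀ c : Literature.RingTheory.LocalCohomology.H2 (y := y) (M := M), ∀ r ∈ Ideal.span (Set.range y) ^ N, r • c = 0 :=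
  fun _R _ _ _s _y _x₁ _x₂ _x₃ hreg h₁ h₂ h₃ M _ _ _a _b Φ Ψ hΦ hrange =>
    Summit.Langlands.Langlands.Theorems.isWeaklyRegular_and_smul_H2_eq_zero_of_secondSyzygy
      hreg h₁ h₂ h₃ M Φ Ψ hΦ hrange

end Summit.Langlands.Langlands.Cruxes.ReducibleOrdinaryProModular.FineSelmerCodimensionTwo
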